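import Mathlib
import HarnessLib
import Literature.MathematicalPhysics.StatisticalMechanics.MuGSC

/-!
# OverbindingBudget — local-matching compactness over `Match` (port)
(decomp-a2c lens 4, generation 21; helper `--supports stmt-AtomisticToContinuum-31280`; part of the node «RecurrentSeal», whose
statement and reading are in `…Theorems.OverbindingBudgetRecurrentSeal`)

Sequential compactness of `δ`-separated point sets of `ℝᵈ` in the local matching topology, stated with the two-way matching predicate
`Match ε R 0 A B` of `MuGSC.lean`: every sequence has a subsequence converging (two-way `ε`-matched on every ball `B(0,R)`, eventually) to a
`δ`-separated limit (`exists_subseq_forall_eventually_match`), via the Kuratowski lower limit along a probe-saturated subsequence.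

PORT NOTE.  This is the sorry-free Literature kernel `LocalMatchingCompactness` (over `MuGroundStateConfiguration.lean`, predicate `BallMatch`)
re-proved VERBATIM over `MuGSC.lean` (`BallMatch ε R A B` ↦ `Match ε R 0 A B`): the two Literature files both declare
`Literature.MathematicalPhysics.StatisticalMechanics.UniformlyDiscrete`, so no file can import both (checked: «environment already contains …»),
and every OverbindingBudget file lives over `MuGSC.lean`.  Nothing here is new mathematics. [folklore]
-/

noncomputable section

namespace Summit.AtomisticToContinuum.Crystallization.Theorems.OverbindingBudgetMatchCompactness

open Filter Metric Set Topology
open Literature.MathematicalPhysics.StatisticalMechanics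

variable {d : ℕ}

/-! ## §A  Local-matching compactness over `Match` (port of Literature `LocalMatchingCompactness`; finiteness of separated sets in balls is
`UniformlyDiscrete.finite_inter_closedBall` of `MuGSC`) -/

/-- The **Kuratowski lower limit** `Li Z_k` of a sequence of point sets `Z_k ⊆ ℝᵈ`: the points
`p` such that for every `ε > 0`, eventually in `k`, `Z_k` has a point within `ε` of `p`
(equivalently `dist(p, Z_k) → 0`). [folklore] -/
def kuratowskiLiminf (Z : ℕ → Set (EuclideanSpace ℝ (Fin d))) : Set (EuclideanSpace ℝ (Fin d)) :=
  {p | ∀ ε : ℝ, 0 < ε → ∀ᶠ k in atTop, ∃ q ∈ Z k, dist q p < ε}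

/-- Unfolding of `kuratowskiLiminf`. [folklore] -/
theorem mem_kuratowskiLiminf_iff {Z : ℕ → Set (EuclideanSpace ℝ (Fin d))}
    {p : EuclideanSpace ℝ (Fin d)} :
    p ∈ kuratowskiLiminf Z ↔ ∀ ε : ℝ, 0 < ε → ∀ᶠ k in atTop, ∃ q ∈ Z k, dist q p < ε :=
  Iff.rfl

/-- The limit set of `δ`-separated sets is `δ`-separated. [folklore] -/
theorem le_dist_of_mem_kuratowskiLiminf {Z : ℕ → Set (EuclideanSpace ℝ (Fin d))} {δ : ℝ}
    (hsep : ∀ k, ∀ p ∈ Z k, ∀ q ∈ Z k, p ≠ q → δ ≤ dist p q)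
    {p q : EuclideanSpace ℝ (Fin d)} (hp : p ∈ kuratowskiLiminf Z) (hq : q ∈ kuratowskiLiminf Z)
    (hpq : p ≠ q) : δ ≤ dist p q := by
  have hpq0 : 0 < dist p q := dist_pos.2 hpq
  refine le_of_forall_pos_lt_add fun η hη => ?_
  set ε : ℝ := min (η / 4) (dist p q / 4) with hε
  have hε0 : 0 < ε := lt_min (by linarith) (by linarith)
  have hεη : ε ≤ η / 4 := min_le_left _ _
  have hεpq : ε ≤ dist p q / 4 := min_le_right _ _
  obtain ⟨k, ⟨a, ha, hap⟩, ⟨b, hb, hbq⟩⟩ := ((hp ε hε0).and (hq ε hε0)).exists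
  by_cases hab : a = b
  · subst hab
    have : dist p q < 2 * ε :=
      calc dist p q ≤ dist a p + dist a q := dist_triangle_left _ _ _
        _ < ε + ε := add_lt_add hap hbq
        _ = 2 * ε := by ring
    linarith
  · have h1 := hsep k a ha b hb hab
    have : dist a b < dist p q + 2 * ε :=
      calc dist a b ≤ dist a p + dist p b := dist_triangle _ _ _
        _ ≤ dist a p + (dist p q + dist b q) := add_le_add le_rfl (dist_triangle_right _ _ _)
        _ < ε + (dist p q + ε) := add_lt_add_of_lt_of_le hap (add_le_add le_rfl hbq.le)
        _ = dist p q + 2 * ε := by ring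
    linarith

/-! ## §A (iii)  Sequential compactness -/

/-- **Probe extraction.** For every sequence of point sets `Y_k ⊆ ℝᵈ` there is a subsequence
`φ` along which approach is stable: whenever `Y_(φ k)` comes within every `ε` of a point `p`
for infinitely many `k`, it does so for all large `k`, i.e. `p ∈ kuratowskiLiminf (Y ∘ φ)`.
(Record for each probe ball `B(u n, r)`, `u` a dense sequence, `r ∈ ℚ`, whether `Y_k` meets
it; extract a subsequence along which every probe is eventually constant, by compactness and
first countability of `ℕ × ℚ → Bool`.) [folklore] -/
theorem exists_subseq_mem_kuratowskiLiminf_of_frequently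
    (Ys : ℕ → Set (EuclideanSpace ℝ (Fin d))) :
    ∃ φ : ℕ → ℕ, StrictMono φ ∧ ∀ p : EuclideanSpace ℝ (Fin d),
      (∀ ε : ℝ, 0 < ε → ∃ᶠ k in atTop, ∃ q ∈ Ys (φ k), dist q p < ε) →
        p ∈ kuratowskiLiminf (fun k => Ys (φ k)) := by
  classical
  obtain ⟨u, hu⟩ := TopologicalSpace.exists_dense_seq (EuclideanSpace ℝ (Fin d))
  let probe : ℕ → (ℕ × ℚ → Bool) := fun k nr =>
    decide (∃ q ∈ Ys k, dist q (u nr.1) < ((nr.2 : ℚ) : ℝ))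
  obtain ⟨L, φ, hφ, hL⟩ := CompactSpace.tendsto_subseq probe
  -- every probe is eventually constant along `φ`; hence frequently meeting ⟹ eventually meeting
  have hKey0 : ∀ (n : ℕ) (r : ℚ), (∃ᶠ k in atTop, ∃ q ∈ Ys (φ k), dist q (u n) < (r : ℝ)) →
      ∀ᶠ k in atTop, ∃ q ∈ Ys (φ k), dist q (u n) < (r : ℝ) := by
    intro n r hfr
    have ht : Tendsto (fun k => probe (φ k) (n, r)) atTop (𝓝 (L (n, r))) :=
      tendsto_pi_nhds.1 hL (n, r)
    rw [nhds_discrete Bool, tendsto_pure] at ht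
    cases hLnr : L (n, r) with
    | true =>
      filter_upwards [ht] with k hk
      rw [hLnr] at hk
      simpa [probe] using hk
    | false =>
      exfalso
      obtain ⟨k, hk1, hk2⟩ := (hfr.and_eventually ht).exists
      rw [hLnr] at hk2
      simp only [probe, decide_eq_false_iff_not] at hk2
      exact hk2 hk1
  refine ⟨φ, hφ, fun p hp ε hε => ?_⟩
  -- a rational radius `r < ε / 2` and a probe centre within `r / 2` of `p`
  obtain ⟨r, hr0, hrε⟩ := exists_rat_btwn (half_pos hε)
  have hr0' : (0 : ℝ) < r := by exact_mod_cast hr0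
  obtain ⟨n, hn⟩ := hu.exists_dist_lt p (half_pos hr0')
  have hfr : ∃ᶠ k in atTop, ∃ q ∈ Ys (φ k), dist q (u n) < (r : ℝ) := by
    refine (hp (r / 2) (half_pos hr0')).mono fun k ⟨q, hq, hqp⟩ => ⟨q, hq, ?_⟩
    calc dist q (u n) ≤ dist q p + dist p (u n) := dist_triangle _ _ _
      _ < r / 2 + r / 2 := add_lt_add hqp hn
      _ = r := by ring
  filter_upwards [hKey0 n r hfr] with k ⟨q, hq, hqn⟩
  refine ⟨q, hq, ?_⟩
  calc dist q p ≤ dist q (u n) + dist p (u n) := dist_triangle_right _ _ _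
    _ < r + r / 2 := add_lt_add hqn hn
    _ < ε := by linarith

/-- **Sequential compactness of uniformly discrete point sets in the local matching topology**
(Baake–Lenz 2004; Baake–Grimm 2013, Remark 5.6, sequential form, sets not necessarily
relatively dense). Let `δ > 0` and let `Y_k ⊆ ℝᵈ` be `δ`-separated for every `k`. Then there
are a strictly increasing `φ : ℕ → ℕ` and a `δ`-separated `Y ⊆ ℝᵈ` (possibly empty) such that
for every `R` and every `ε > 0`, eventually in `k`, `Y_(φ k)` and `Y` are two-way `ε`-matched
on the closed ball of radius `R` about `0`: `Match ε R 0 (Y_(φ k)) Y`. [folklore] -/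
theorem exists_subseq_forall_eventually_match {δ : ℝ} (hδ : 0 < δ)
    (Ys : ℕ → Set (EuclideanSpace ℝ (Fin d)))
    (hsep : ∀ k, ∀ p ∈ Ys k, ∀ q ∈ Ys k, p ≠ q → δ ≤ dist p q) :
    ∃ (φ : ℕ → ℕ) (Y : Set (EuclideanSpace ℝ (Fin d))), StrictMono φ ∧
      (∀ p ∈ Y, ∀ q ∈ Y, p ≠ q → δ ≤ dist p q) ∧
      ∀ R ε : ℝ, 0 < ε → ∀ᶠ k in atTop, Match ε R 0 (Ys (φ k)) Y := by
  obtain ⟨φ, hφ, hKey⟩ := exists_subseq_mem_kuratowskiLiminf_of_frequently Ys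
  set Y := kuratowskiLiminf (fun k => Ys (φ k)) with hY
  have hsepφ : ∀ k, ∀ p ∈ Ys (φ k), ∀ q ∈ Ys (φ k), p ≠ q → δ ≤ dist p q := fun k => hsep (φ k)
  have hYsep : ∀ p ∈ Y, ∀ q ∈ Y, p ≠ q → δ ≤ dist p q :=
    fun p hp q hq hpq => le_dist_of_mem_kuratowskiLiminf hsepφ hp hq hpq
  refine ⟨φ, Y, hφ, hYsep, fun R ε hε => ?_⟩
  -- (1) points of `Y` in the ball are matched: finitely many, each eventually approached
  have hfin : (Y ∩ closedBall 0 R).Finite :=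
    UniformlyDiscrete.finite_inter_closedBall (X := Y) ⟨δ, hδ, hYsep⟩ 0 R
  have h1 : ∀ᶠ k in atTop, ∀ p ∈ Y ∩ closedBall (0 : EuclideanSpace ℝ (Fin d)) R,
      ∃ q ∈ Ys (φ k), dist q p < ε :=
    hfin.eventually_all.2 fun p hp => hp.1 ε hε
  -- (2) particles in the ball are matched: by contradiction and compactness of the ball
  have h2 : ∀ᶠ k in atTop, ∀ q ∈ Ys (φ k), ‖q‖ ≤ R → ∃ p ∈ Y, dist q p ≤ ε := by
    by_contra hcon
    obtain ⟨ψ, hψ, hψP⟩ := extraction_of_frequently_atTop (not_eventually.1 hcon)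
    have hq : ∀ l, ∃ q ∈ Ys (φ (ψ l)), ‖q‖ ≤ R ∧ ∀ p ∈ Y, ε < dist q p := by
      intro l
      have := hψP l
      push Not at this
      exact this
    choose q hqY hqR hfar using hq
    obtain ⟨a, -, θ, hθ, hlimq⟩ :=
      (isCompact_closedBall (0 : EuclideanSpace ℝ (Fin d)) R).tendsto_subseq (x := q)
        fun l => mem_closedBall_zero_iff.2 (hqR l)
    have ha : a ∈ Y := by
      refine hKey a fun ε' hε' => ?_
      have hi : ∀ᶠ i in atTop, dist (q (θ i)) a < ε' := Metric.tendsto_nhds.1 hlimq ε' hε'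
      refine frequently_atTop.2 fun K => ?_
      obtain ⟨i, hi', hiK⟩ := (hi.and (eventually_ge_atTop K)).exists
      exact ⟨ψ (θ i), hiK.trans (hθ.le_apply.trans hψ.le_apply), q (θ i), hqY (θ i), hi'⟩
    obtain ⟨i, hi⟩ := (Metric.tendsto_nhds.1 hlimq ε hε).exists
    exact lt_irrefl _ ((hfar (θ i) a ha).trans hi)
  filter_upwards [h1, h2] with k hk1 hk2
  refine ⟨fun s hs hsR => ?_, fun a ha haR => ?_⟩
  · obtain ⟨b, hb, hbs⟩ := hk1 s ⟨hs, mem_closedBall.2 hsR⟩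
    exact ⟨b, hb, hbs.le⟩
  · exact hk2 a ha (by rwa [dist_zero_right] at haR)

end Summit.AtomisticToContinuum.Crystallization.Theorems.OverbindingBudgetMatchCompactness

end
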